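import Summits.BirchSwinnertonDyer.BirchSwinnertonDyer.Theorems.KatoDescentPotSupersingularZetaBodyScaling
import Literature.NumberTheory.EllipticCurves.Kato2004.EulerSystemClassNonvanishingProofs
import HarnessLib

/-!
# The Λ-adic zeta LINE, not the zeta CLASS, is what the tree pins: «the lift of every zeta body is
# `p`-indivisible in `𝐇¹_Γ`» is FALSE on every row carrying one guarded body (kernel obstruction), and the
# scale-invariant replacement «the `p`-saturation of the zeta line is generated by a genuine Euler-system class»

Seat `bsd-potss-k9-c4` g15 (prover; cell `bsd-potss`), route-free, `--supports stmt-BirchSwinnertonDyer-19942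
--as helper`.  HONEST FRAMING: BSD is not advanced; nothing is booked; no Literature fact is minted; this file
proves an OBSTRUCTION to a proposed crux statement and the bookkeeping of its replacement.

Context.  Plan g25's split-kit spec for the Conj-A residue cruxes 19942 (K9) / 19916 (KT)
(`HOME/plan/rekey-g25/SPLITKIT-19942-19916-spec.md`) pins «`μ_p` of Kato's zeta class `= 0`» as: for every
`ZetaBody W p f ι κ' Λ' c d a A z x` witness and every `y ∈ 𝐇¹_Γ(T_pW)` lifting the corestricted `p`-power line
of `z` (`IwasawaH1Data.existsUnique_lift_of_zetaBody`), `y ≠ 0 → y ∉ p·𝐇¹_Γ`.  But the matrix `ZetaBody` is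
HOMOGENEOUS (kmc g10, `ZetaBodyScaling.zetaBody_smul`): `(n·κ', Λ', n•z, n·x)` is again a zeta body for the SAME
auxiliary datum, with the same guards, and its lift is `n • y` (`ZetaBodyScaling.zetaLift_smul`).  With `n = p`
the proposed statement asserts `p • y ∉ p·𝐇¹_Γ` for a non-zero `p • y` — false.  §1 proves this in the kernel:
ONE guarded zeta body with the value guard on a curve with `L(W,1) ≠ 0` refutes the naively pinned statement
(`not_forall_zetaBody_lift_not_mem`), hence (§1, `exists_zetaBody_refuting_naivePin`) Kato's construction fact
`exists_eulerSystem_expStar_values` + a newform + `L(W,1) ≠ 0` + `W[p]` irreducible refute it on every such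
row.  §2 records the SCALE-INVARIANT replacement used by the g15 split kit: «for every zeta body and every
non-zero lift `y`, some genuine Euler-system class `s ∉ p·𝐇¹_Γ` has `p^k • s = y`» — i.e. the `p`-indivisible
generator of the `p`-saturated zeta line is (a unit times) an Euler-system class; it is stable under
`y ↦ n • y` (`zetaLineSaturated_smul`) and implies the existential input of k9-c4 g14's `μ`-core
(`exists_eulerClass_not_mem_of_zetaLineSaturated`).  What it does NOT give: a per-row certificate — the free
real constant `κ'` of the abstract dual-exponential datum (design (P2)/F-κ of `EulerSystemValues.lean`) makes
the position of `y` in `𝐇¹_Γ` invisible to the values; a certificate needs an `ω_E`-normalised `exp*` (cf. the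
(P-EXP) rider `Rank1Residual.GaloisImage.KatoExpStarFiniteLevelAt` and `hNorm₃` of the n1011 PORT).

References: K. Kato, Astérisque 295 (2004) §13.1, Thm. 13.4 (pp. 224–226), Ex. 13.3 (p. 225), Thm. 12.5 (1)
(pp. 221–222) [Kato2004Asterisque]; tree `Theorems/KatoDescentPotSupersingularZetaBodyScaling.lean` (kmc g10),
`Kato2004/EulerSystemClassNonvanishingProofs.lean`.
-/

set_option autoImplicit false
-- the summit and its single problem are both named `BirchSwinnertonDyer` (registry layout D-0017)
set_option linter.dupNamespace false

noncomputable section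

open scoped NumberField TensorProduct
open Field IsDedekindDomain CongruenceSubgroup
open Literature.NumberTheory.GaloisRepresentations
open Literature.NumberTheory.EllipticCurves Literature.NumberTheory.EllipticCurves.ModularForms
open Literature.NumberTheory.EllipticCurves.Kato2004
open Literature.NumberTheory.EllipticCurves.Kato2004.EulerSystemValues Rat.HeightOneSpectrum

namespace Summit.BirchSwinnertonDyer.BirchSwinnertonDyer.Theorems.ZetaLineScaling

variable {W : WeierstrassCurve ℚ} [W.IsElliptic] {p : ℕ} [Fact p.Prime]
  [ContinuousSMul ℤ_[p] (W.tateModule p)] [Module.Free ℤ_[p] (W.tateModule p)]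
  [Module.Finite ℤ_[p] (W.tateModule p)] {κ : ZpExtension ℚ p} (hκ : κ.IsCyclotomic) (hp : p ≠ 2)
  {γ : absoluteGaloisGroup ℚ} (I : IwasawaH1Data W p κ γ)

/-! ## §0 `p • y ∈ (p)·𝐇¹_Γ` -/

omit [Module.Free ℤ_[p] (W.tateModule p)] [Module.Finite ℤ_[p] (W.tateModule p)] in
/-- `p^(k+1) • y` lies in `(p)·𝐇¹_Γ` (`augIdealP p = (p) ⊂ Λ`). [folklore] -/
theorem pow_succ_smul_mem_augIdealP_smul_top (y : I.H) (k : ℕ) :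
    (p ^ (k + 1) : ℕ) • y ∈ IwasawaAlgebra.augIdealP p • (⊤ : Submodule (IwasawaAlgebra p) I.H) := by
  have hC : (PowerSeries.C (p : ℤ_[p]) : IwasawaAlgebra p) ∈ IwasawaAlgebra.augIdealP p :=
    Ideal.subset_span rfl
  have hmem : (PowerSeries.C (p : ℤ_[p]) : IwasawaAlgebra p) • ((p ^ k : ℕ) • y) ∈
      IwasawaAlgebra.augIdealP p • (⊤ : Submodule (IwasawaAlgebra p) I.H) :=
    Submodule.smul_mem_smul hC Submodule.mem_top
  have hcast : (PowerSeries.C (p : ℤ_[p]) : IwasawaAlgebra p) = ((p : ℕ) : IwasawaAlgebra p) := by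
    rw [← map_natCast (PowerSeries.C (R := ℤ_[p])) p]
  rw [hcast, Nat.cast_smul_eq_nsmul, ← mul_nsmul', ← pow_succ'] at hmem
  exact hmem

omit [Module.Free ℤ_[p] (W.tateModule p)] [Module.Finite ℤ_[p] (W.tateModule p)] in
/-- `p • y` lies in `(p)·𝐇¹_Γ`. [folklore] -/
theorem prime_smul_mem_augIdealP_smul_top (y : I.H) :
    p • y ∈ IwasawaAlgebra.augIdealP p • (⊤ : Submodule (IwasawaAlgebra p) I.H) := by
  simpa using pow_succ_smul_mem_augIdealP_smul_top (p := p) I y 0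

/-! ## §1 The obstruction: the naively pinned indivisibility is refuted by ONE guarded zeta body -/

/-- **The naive pin is false.**  Let `f` be the newform of `W`, `L(W,1) ≠ 0`, and let
`(κ', Λ', z, x)` be a zeta body for an admissible datum `(c, d, a, A)` (`A ≥ 1`, Kato's guards
`(c, 6pA) = (d, 6pN) = 1`) with `κ' ≠ 0` and the value guard (`(cd, A) = 1`, `dd′ ≡ 1 (A)`, `R⁻ ≠ 0`).  Then it is
FALSE that every zeta body `(κ'', Λ', z'', x'')` for the same datum has all its non-zero Λ-adic lifts outside
`p·𝐇¹_Γ`: the `p`-scaled body (`ZetaBodyScaling.zetaBody_smul`) has lift `p • y ≠ 0`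
(`ZetaBodyScaling.zetaLift_smul`, `zetaBody_bottom_ne_zero`, `lift_ne_zero_of_bottom_ne_zero`), which lies in
`p·𝐇¹_Γ`.  Odd `p`. [cite: Kato2004Asterisque, §13.1 and Thm. 13.4 (pp. 224–226), Ex. 13.3 (p. 225), Thm. 12.5 (1) (pp. 221–222)] -/
theorem not_forall_zetaBody_lift_not_mem {N : ℕ} [NeZero N] {f : CuspForm (Gamma0 N) 2}
    (hf : IsNewformOf W f) (hL1 : W.entireLFunction 1 ≠ 0)
    {ι : (m : ℕ) → (CyclotomicField m ℚ →+* ℂ)} {κ' : ℝ} (hκ' : κ' ≠ 0)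
    {Λ' : ∀ (k : ℕ) (r : Finset (HeightOneSpectrum (𝓞 ℚ))),
      H1 (tateRep W p) (cycSubgroup p k r) →ₗ[ℤ_[p]] ℚ_[p] ⊗[ℚ] CyclotomicField (cycLevel p k r) ℚ}
    {c d a : ℤ} {A : ℕ} (hA : 0 < A) {d' : ℤ} (hcd : Int.gcd (c * d) A = 1)
    (hdd' : d * d' ≡ 1 [ZMOD (A : ℤ)]) (hR : cuspFactor f true (fun _ ↦ (1 : ℂ)) c d a A d' ≠ 0)
    {z : ∀ (k : ℕ) (r : (cyclotomicLevelsRat p (badPlaces c d A N)).Ideals),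
      H1 (tateRep W p) ((cyclotomicLevelsRat p (badPlaces c d A N)).level k r.1)}
    {x : ∀ (k : ℕ) (r : (cyclotomicLevelsRat p (badPlaces c d A N)).Ideals),
      CyclotomicField (cycLevel p k r.1) ℚ}
    (hbody : ZetaBody W p f ι κ' Λ' c d a A z x) :
    ¬ (∀ (κ'' : ℝ)
        (z'' : ∀ (k : ℕ) (r : (cyclotomicLevelsRat p (badPlaces c d A N)).Ideals),
          H1 (tateRep W p) ((cyclotomicLevelsRat p (badPlaces c d A N)).level k r.1))
        (x'' : ∀ (k : ℕ) (r : (cyclotomicLevelsRat p (badPlaces c d A N)).Ideals),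
          CyclotomicField (cycLevel p k r.1) ℚ),
        ZetaBody W p f ι κ'' Λ' c d a A z'' x'' →
        ∀ y : I.H, (∀ n : ℕ, I.proj n y = levelToLayer W p hκ hp (badPlaces c d A N) n
            (z'' (n + 1) (cyclotomicLevelsRat p (badPlaces c d A N)).idealOne)) →
          y ≠ 0 → y ∉ IwasawaAlgebra.augIdealP p • (⊤ : Submodule (IwasawaAlgebra p) I.H)) := by
  intro H
  -- the lift of the given body
  obtain ⟨y, hy, -⟩ := IwasawaH1Data.existsUnique_lift_of_zetaBody p W hκ hp I f ι κ' Λ' c d a A z x hbody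
  -- the `p`-scaled body and its lift `p • y`
  have hbody' := ZetaBodyScaling.zetaBody_smul p hbody
  have hy' := ZetaBodyScaling.zetaLift_smul hκ hp I (y := y) p hy
  have hκ'' : (p : ℝ) * κ' ≠ 0 := mul_ne_zero (by exact_mod_cast (Fact.out : p.Prime).ne_zero) hκ'
  have hne : p • y ≠ 0 :=
    lift_ne_zero_of_bottom_ne_zero W p hκ I hp (badPlaces c d A N) hbody'.1
      (zetaBody_bottom_ne_zero hbody' hf hκ'' hL1 hA d' hcd hdd' hR) hy'
  exact H _ _ _ hbody' (p • y) hy' hne (prime_smul_mem_augIdealP_smul_top I y)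

/-- **On every row the naive pin is refuted by Kato's construction fact.**  Granted
`exists_eulerSystem_expStar_values` (Kato (8.1.3)/Ex. 13.3 with Thm. 9.7, Thm. 6.6 (1)): for `W[p]` irreducible
(`p` odd), a newform `f` of `W` and `L(W,1) ≠ 0`, there are embeddings `ι`, a dual-exponential datum `Λ'` and an
admissible guarded datum `(c, d, a, A)` such that NOT every zeta body for it has its non-zero lifts outside
`p·𝐇¹_Γ` (an admissible datum with the value guard exists: `valueGuard_satisfiable`).
[cite: Kato2004Asterisque, Ex. 13.3 (p. 225), Lemma 13.10 (1) (p. 230), Thm. 12.5 (1) (pp. 221–222)] -/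
theorem exists_zetaBody_refuting_naivePin (hES : exists_eulerSystem_expStar_values)
    (hirr : W.HasIrreducibleModPGaloisRep p) {N : ℕ} [NeZero N] (f : CuspForm (Gamma0 N) 2)
    (hf : IsNewformOf W f) (hL1 : W.entireLFunction 1 ≠ 0) :
    ∃ (ι : (m : ℕ) → (CyclotomicField m ℚ →+* ℂ))
      (Λ' : ∀ (k : ℕ) (r : Finset (HeightOneSpectrum (𝓞 ℚ))),
        H1 (tateRep W p) (cycSubgroup p k r) →ₗ[ℤ_[p]] ℚ_[p] ⊗[ℚ] CyclotomicField (cycLevel p k r) ℚ)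
      (c d a : ℤ) (A : ℕ), 0 < A ∧ Int.gcd c (6 * p * A) = 1 ∧ Int.gcd d (6 * p * N) = 1 ∧
      ¬ (∀ (κ'' : ℝ)
        (z'' : ∀ (k : ℕ) (r : (cyclotomicLevelsRat p (badPlaces c d A N)).Ideals),
          H1 (tateRep W p) ((cyclotomicLevelsRat p (badPlaces c d A N)).level k r.1))
        (x'' : ∀ (k : ℕ) (r : (cyclotomicLevelsRat p (badPlaces c d A N)).Ideals),
          CyclotomicField (cycLevel p k r.1) ℚ),
        ZetaBody W p f ι κ'' Λ' c d a A z'' x'' →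
        ∀ y : I.H, (∀ n : ℕ, I.proj n y = levelToLayer W p hκ hp (badPlaces c d A N) n
            (z'' (n + 1) (cyclotomicLevelsRat p (badPlaces c d A N)).idealOne)) →
          y ≠ 0 → y ∉ IwasawaAlgebra.augIdealP p • (⊤ : Submodule (IwasawaAlgebra p) I.H)) := by
  set ι : (m : ℕ) → (CyclotomicField m ℚ →+* ℂ) :=
    fun m ↦ Classical.choice (inferInstance : Nonempty (CyclotomicField m ℚ →+* ℂ)) with hι
  obtain ⟨κ', hκ'0, Λ', hfam⟩ := hES W p hirr f hf ι
  obtain ⟨c, d, a, A, d', hA, hc, hd, hcd, hdd', hR⟩ := valueGuard_satisfiable f hf.1 hf.coeffField_eq_bot p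
  obtain ⟨z, x, hbody⟩ := hfam c d a A hA hc hd
  exact ⟨ι, Λ', c, d, a, A, hA, hc, hd,
    not_forall_zetaBody_lift_not_mem hκ hp I hf hL1 hκ'0 hA hcd hdd' hR hbody⟩

/-! ## §2 The scale-invariant replacement: the `p`-saturated zeta line is generated by an Euler-system class -/

/-- **Stability under scaling.**  If some genuine Euler-system class `s ∉ p·𝐇¹_Γ` has `p^k • s = y`, then for
`n • y` the class `n' • s` with `n = p^j · n'`, `p ∤ n'` … — in the only case the obstruction of §1 uses, `n = p`:
the same `s` with exponent `k + 1` works.  So the replacement survives `ZetaBodyScaling.zetaBody_smul p`.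
[cite: Kato2004Asterisque, §13.1 and Thm. 13.4 (pp. 224–226)] -/
theorem zetaLineSaturated_smul {y : I.H}
    (h : ∃ (s : I.H) (k : ℕ), IsEulerSystemClass W p κ γ I s ∧
      s ∉ IwasawaAlgebra.augIdealP p • (⊤ : Submodule (IwasawaAlgebra p) I.H) ∧ (p ^ k : ℕ) • s = y) :
    ∃ (s : I.H) (k : ℕ), IsEulerSystemClass W p κ γ I s ∧
      s ∉ IwasawaAlgebra.augIdealP p • (⊤ : Submodule (IwasawaAlgebra p) I.H) ∧ (p ^ k : ℕ) • s = p • y := by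
  obtain ⟨s, k, hs, hsp, hsy⟩ := h
  refine ⟨s, k + 1, hs, hsp, ?_⟩
  rw [pow_succ, mul_comm, mul_nsmul', hsy]

/-- **The replacement feeds the `μ`-core.**  The saturation statement at any one lift yields the existential
input «some genuine Euler-system class lies outside `p·𝐇¹_Γ`» of k9-c4 g14's
`MuCoreIrr.exists_fineSelmerDualData_moduleFinite_three_of_irr_of_eulerClass` /
`…_of_irr_of_not_towerSurj_of_eulerClass`. [cite: Kato2004Asterisque, §13.8 (pp. 228–229)] -/
theorem exists_eulerClass_not_mem_of_zetaLineSaturated {y : I.H}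
    (h : ∃ (s : I.H) (k : ℕ), IsEulerSystemClass W p κ γ I s ∧
      s ∉ IwasawaAlgebra.augIdealP p • (⊤ : Submodule (IwasawaAlgebra p) I.H) ∧ (p ^ k : ℕ) • s = y) :
    ∃ s : I.H, IsEulerSystemClass W p κ γ I s ∧
      s ∉ IwasawaAlgebra.augIdealP p • (⊤ : Submodule (IwasawaAlgebra p) I.H) := by
  obtain ⟨s, -, hs, hsp, -⟩ := h
  exact ⟨s, hs, hsp⟩

/-! ## §3 (appended, k9-c4 g15) The weakest pinned form — every body lift is a `Λ`-MULTIPLE of a `p`-indivisible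
Euler-system class («the `p`-divisibility of Kato's zeta class, if any, is carried by a scalar of `Λ`») -/

/-- **Stability of the multiple form under scaling**: if `y = a • s` with `s ∉ p·𝐇¹_Γ` a genuine Euler-system class,
then `p • y = (p·a) • s`.  So the multiple form survives `ZetaBodyScaling.zetaBody_smul p` as well.
[cite: Kato2004Asterisque, §13.1 and Thm. 13.4 (pp. 224–226)] -/
theorem zetaMultiple_smul {y : I.H}
    (h : ∃ (s : I.H) (a : IwasawaAlgebra p), IsEulerSystemClass W p κ γ I s ∧
      s ∉ IwasawaAlgebra.augIdealP p • (⊤ : Submodule (IwasawaAlgebra p) I.H) ∧ a • s = y) :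
    ∃ (s : I.H) (a : IwasawaAlgebra p), IsEulerSystemClass W p κ γ I s ∧
      s ∉ IwasawaAlgebra.augIdealP p • (⊤ : Submodule (IwasawaAlgebra p) I.H) ∧ a • s = p • y := by
  obtain ⟨s, a, hs, hsp, hsy⟩ := h
  refine ⟨s, (p : IwasawaAlgebra p) * a, hs, hsp, ?_⟩
  rw [mul_smul, hsy, Nat.cast_smul_eq_nsmul]

/-- **The saturated-line form implies the multiple form** (`a := p^k`): the g15 kit files the WEAKER multiple
form as the crux child; the line form of §2 is the stronger variant. [cite: Kato2004Asterisque, §13.1 (p. 224)] -/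
theorem zetaMultiple_of_zetaLineSaturated {y : I.H}
    (h : ∃ (s : I.H) (k : ℕ), IsEulerSystemClass W p κ γ I s ∧
      s ∉ IwasawaAlgebra.augIdealP p • (⊤ : Submodule (IwasawaAlgebra p) I.H) ∧ (p ^ k : ℕ) • s = y) :
    ∃ (s : I.H) (a : IwasawaAlgebra p), IsEulerSystemClass W p κ γ I s ∧
      s ∉ IwasawaAlgebra.augIdealP p • (⊤ : Submodule (IwasawaAlgebra p) I.H) ∧ a • s = y := by
  obtain ⟨s, k, hs, hsp, hsy⟩ := h
  refine ⟨s, ((p ^ k : ℕ) : IwasawaAlgebra p), hs, hsp, ?_⟩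
  rw [Nat.cast_smul_eq_nsmul, hsy]

/-- **The multiple form feeds the `μ`-core**: it yields «some genuine Euler-system class lies outside `p·𝐇¹_Γ`», the
input of k9-c4 g14's `MuCoreIrr.exists_fineSelmerDualData_moduleFinite_…_of_eulerClass`.
[cite: Kato2004Asterisque, §13.8 (pp. 228–229)] -/
theorem exists_eulerClass_not_mem_of_zetaMultiple {y : I.H}
    (h : ∃ (s : I.H) (a : IwasawaAlgebra p), IsEulerSystemClass W p κ γ I s ∧
      s ∉ IwasawaAlgebra.augIdealP p • (⊤ : Submodule (IwasawaAlgebra p) I.H) ∧ a • s = y) :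
    ∃ s : I.H, IsEulerSystemClass W p κ γ I s ∧
      s ∉ IwasawaAlgebra.augIdealP p • (⊤ : Submodule (IwasawaAlgebra p) I.H) := by
  obtain ⟨s, -, hs, hsp, -⟩ := h
  exact ⟨s, hs, hsp⟩

end Summit.BirchSwinnertonDyer.BirchSwinnertonDyer.Theorems.ZetaLineScaling

end
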